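import Mathlib
import Summits.AtomisticToContinuum.FouriersLaw.Theorems.EmbeddedDrudeMourreAbelOfSpectralDensity
import HarnessLib

/-!
# Locally uniform Poisson approximate identity — `stub_poissonLocallyUniform` (stub B2) of line `swap-odd-threshold-rigidity`
(crux `EmbeddedDrudeMourre.MourreDissolution`, item stmt-AtomisticToContinuum-12594; helper file, `--supports`)

If a finite measure `m` on `ℝ` coincides on the window `(-δ, δ)` with `ρ dx` for a continuous
`ρ ≥ 0`, then `E ↦ ∫ ν/((x - E)² + ν²) dm(x)` converges to `π ρ(E)` locally uniformly on the window
as `ν ↓ 0` — the locally uniform upgrade of the pointwise statement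
`AbelOfSpectralDensity.tendsto_setIntegral_poisson_mul`, reusing that file's kernel lemmas.

Proof. Around `E₀ ∈ (-δ, δ)` fix `r > 0` with `[E₀ - 2r, E₀ + 2r] ⊆ (-δ, δ)`; on this compact set
`ρ` is bounded by some `R` and uniformly continuous. For a centre `E ∈ [E₀ - r, E₀ + r]` and
`ν > 0` split `∫ ν/((x-E)²+ν²) dm` into the part over `(E - r, E + r)` and its complement: the
complement is at most `(ν/r²)·m(ℝ)` (`poissonLU_norm_setIntegral_compl_le`); on
`(E - r, E + r) ⊆ (-δ, δ)` the measure is `ρ dx` (`poissonLU_restrict_eq_withDensity`), and after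
the translation `x = E + y` the window part is `∫_{(-r,r)} ν/(ν²+y²) ρ(E+y) dy`, to which the core
estimate `AbelOfSpectralDensity.abs_setIntegral_poisson_mul_sub_le` applies with constants that
do not depend on `E` (`poissonLU_abs_integral_sub_le`). Choosing the tolerance `ε/(4π)` and then
`ν` small gives uniform convergence on `[E₀ - r, E₀ + r]`, whence local uniformity
(`tendstoLocallyUniformlyOn_of_forall_exists_nhds`). Pure real analysis; no cited facts.
-/

noncomputable section

namespace Summit.AtomisticToContinuum.FouriersLaw.Theorems.MourreDissolution

open MeasureTheory Filter Set Function Topology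
open scoped ENNReal NNReal

/-! ### The shifted Poisson kernel `ν/((x - E)² + ν²)` -/

/-- The shifted Poisson kernel `x ↦ ν/((x - E)² + ν²)` (`ν > 0`) is continuous and bounded by
`1/ν`, hence integrable against any finite measure. [folklore] -/
theorem poissonLU_integrable_shift (σ : Measure ℝ) [IsFiniteMeasure σ] (E : ℝ) {ν : ℝ}
    (hν : 0 < ν) : Integrable (fun x : ℝ => ν / ((x - E) ^ 2 + ν ^ 2)) σ := by
  refine (integrable_const (1 / ν)).mono' (Continuous.aestronglyMeasurable ?_)
    (ae_of_all _ (fun x => ?_))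
  · exact continuous_const.div (by fun_prop) (fun x => by positivity)
  · rw [Real.norm_eq_abs, abs_of_nonneg (by positivity), div_le_div_iff₀ (by positivity) hν,
      one_mul]
    nlinarith [sq_nonneg (x - E)]

/-- Outside the window `(E - r, E + r)` the shifted Poisson kernel is at most `ν/r²`, so
`‖∫_{(E-r,E+r)ᶜ} ν/((x-E)²+ν²) dσ(x)‖ ≤ (ν/r²)·σ(ℝ)`. [folklore] -/
theorem poissonLU_norm_setIntegral_compl_le (σ : Measure ℝ) [IsFiniteMeasure σ] (E : ℝ)
    {r ν : ℝ} (hr : 0 < r) (hν : 0 ≤ ν) :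
    ‖∫ x in (Ioo (E - r) (E + r))ᶜ, ν / ((x - E) ^ 2 + ν ^ 2) ∂σ‖ ≤ ν / r ^ 2 * σ.real univ := by
  calc ‖∫ x in (Ioo (E - r) (E + r))ᶜ, ν / ((x - E) ^ 2 + ν ^ 2) ∂σ‖
      ≤ ν / r ^ 2 * σ.real (Ioo (E - r) (E + r))ᶜ := by
        refine norm_setIntegral_le_of_norm_le_const (measure_lt_top σ _) (fun x hx => ?_)
        rw [Real.norm_eq_abs, abs_of_nonneg (by positivity)]
        have hxE : r ≤ |x - E| := by
          simp only [mem_compl_iff, mem_Ioo, not_and_or, not_lt] at hx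
          rcases hx with h | h
          · rw [le_abs]; right; linarith
          · rw [le_abs]; left; linarith
        have hrx : r ^ 2 ≤ (x - E) ^ 2 := by
          calc r ^ 2 ≤ |x - E| ^ 2 := pow_le_pow_left₀ hr.le hxE 2
            _ = (x - E) ^ 2 := sq_abs _
        have hx2 : 0 < (x - E) ^ 2 := lt_of_lt_of_le (by positivity) hrx
        calc ν / ((x - E) ^ 2 + ν ^ 2) ≤ ν / (x - E) ^ 2 :=
              div_le_div_of_nonneg_left hν hx2 (le_add_of_nonneg_right (sq_nonneg ν))
          _ ≤ ν / r ^ 2 := div_le_div_of_nonneg_left hν (by positivity) hrx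
    _ ≤ ν / r ^ 2 * σ.real univ :=
        mul_le_mul_of_nonneg_left (measureReal_mono (subset_univ _)) (by positivity)

/-! ### The window: density, translation, integrability -/

/-- If `σ` restricted to a measurable set `s` is Lebesgue measure with density `g ≥ 0` (`g`
a.e.-measurable there), then `σ`-integrals over `s` are Lebesgue integrals against `g` (the
general-window form of `AbelOfSpectralDensity.setIntegral_eq_of_restrict_eq_withDensity`).
[folklore] -/
theorem poissonLU_setIntegral_eq_of_restrict_eq_withDensity {σ : Measure ℝ} {s : Set ℝ}
    (hs : MeasurableSet s) {g : ℝ → ℝ} (hg0 : ∀ ω ∈ s, 0 ≤ g ω)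
    (hgm : AEMeasurable g (volume.restrict s))
    (hσ : σ.restrict s = (volume.restrict s).withDensity (fun ω => ENNReal.ofReal (g ω)))
    (f : ℝ → ℝ) :
    ∫ ω in s, f ω ∂σ = ∫ ω in s, f ω * g ω := by
  rw [hσ]
  have : (fun ω => ENNReal.ofReal (g ω)) = fun ω => ((fun ω => (g ω).toNNReal) ω : ℝ≥0∞) := rfl
  rw [this, integral_withDensity_eq_integral_smul₀ hgm.real_toNNReal]
  refine setIntegral_congr_fun hs (fun ω hω => ?_)
  simp only [NNReal.smul_def, smul_eq_mul, Real.coe_toNNReal _ (hg0 ω hω), mul_comm (g ω)]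

/-- The density hypothesis descends to measurable sub-windows: if `m = ρ dx` on `(-δ, δ)` and
`I ⊆ (-δ, δ)` is measurable, then `m = ρ dx` on `I`. [folklore] -/
theorem poissonLU_restrict_eq_withDensity {m : Measure ℝ} {δ : ℝ} {ρ : ℝ → ℝ}
    (hwin : m.restrict (Ioo (-δ) δ) =
      (volume.restrict (Ioo (-δ) δ)).withDensity (fun x => ENNReal.ofReal (ρ x)))
    {I : Set ℝ} (hI : MeasurableSet I) (hIW : I ⊆ Ioo (-δ) δ) :
    m.restrict I = (volume.restrict I).withDensity (fun x => ENNReal.ofReal (ρ x)) := by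
  calc m.restrict I = (m.restrict (Ioo (-δ) δ)).restrict I :=
        (Measure.restrict_restrict_of_subset hIW).symm
    _ = (volume.restrict I).withDensity (fun x => ENNReal.ofReal (ρ x)) := by
        rw [hwin, restrict_withDensity hI, Measure.restrict_restrict_of_subset hIW]

/-- The translation `y ↦ E + y` pulls the window `(E - r, E + r)` back to `(-r, r)`. [folklore] -/
theorem poissonLU_preimage_const_add_Ioo (E r : ℝ) :
    (fun x => E + x) ⁻¹' Ioo (E - r) (E + r) = Ioo (-r) r := by
  ext y
  simp only [mem_preimage, mem_Ioo]
  constructor <;> rintro ⟨h1, h2⟩ <;> constructor <;> linarith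

/-- Translation `x = E + y` of the window integral:
`∫_{(E-r,E+r)} ν/((x-E)²+ν²) ρ(x) dx = ∫_{(-r,r)} ν/(ν²+y²) ρ(E+y) dy`. [folklore] -/
theorem poissonLU_setIntegral_comp_add (ρ : ℝ → ℝ) (E r ν : ℝ) :
    ∫ x in Ioo (E - r) (E + r), ν / ((x - E) ^ 2 + ν ^ 2) * ρ x =
      ∫ y in Ioo (-r) r, ν / (ν ^ 2 + y ^ 2) * ρ (E + y) := by
  have h : ∫ y in (fun x => E + x) ⁻¹' Ioo (E - r) (E + r),
      ν / ((E + y - E) ^ 2 + ν ^ 2) * ρ (E + y) =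
        ∫ x in Ioo (E - r) (E + r), ν / ((x - E) ^ 2 + ν ^ 2) * ρ x :=
    (measurePreserving_add_left volume E).setIntegral_preimage_emb (measurableEmbedding_addLeft E)
      (fun x => ν / ((x - E) ^ 2 + ν ^ 2) * ρ x) (Ioo (E - r) (E + r))
  rw [← h, poissonLU_preimage_const_add_Ioo]
  refine setIntegral_congr_fun measurableSet_Ioo (fun y _ => ?_)
  have h2 : (E + y - E) ^ 2 + ν ^ 2 = ν ^ 2 + y ^ 2 := by ring
  rw [h2]

/-- Translation of integrability: if `ρ` is integrable on `(E - r, E + r)` then `y ↦ ρ (E + y)`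
is integrable on `(-r, r)`. [folklore] -/
theorem poissonLU_integrableOn_comp_add {ρ : ℝ → ℝ} {E r : ℝ}
    (h : IntegrableOn ρ (Ioo (E - r) (E + r))) :
    IntegrableOn (fun y => ρ (E + y)) (Ioo (-r) r) := by
  have h2 := ((measurePreserving_add_left volume E).integrableOn_comp_preimage
    (measurableEmbedding_addLeft E)).2 h
  rw [poissonLU_preimage_const_add_Ioo] at h2
  exact h2

/-! ### The per-centre estimate, uniform in the centre -/

/-- **Per-centre estimate with constants independent of the centre.** If `m = ρ dx` on `(-δ, δ)`
with `ρ ≥ 0` continuous there, `(E - r, E + r) ⊆ (-δ, δ)`, `|ρ(E+y) - ρ(E)| ≤ R` for `|y| < r`,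
`|ρ(E)| ≤ R'` and `|ρ(E+y) - ρ(E)| ≤ e` for `|y| < η`, then for `ν > 0`
`|∫ ν/((x-E)²+ν²) dm(x) - π ρ(E)| ≤ π e + ν·(R·|(-r,r)|/η² + 2R'/r + m(ℝ)/r²)`
(window/tail split, density and translation on the window, then
`AbelOfSpectralDensity.abs_setIntegral_poisson_mul_sub_le` at centre `0` for `y ↦ ρ(E+y)`).
[folklore] -/
theorem poissonLU_abs_integral_sub_le {m : Measure ℝ} [IsFiniteMeasure m] {δ : ℝ} {ρ : ℝ → ℝ}
    (hρc : ContinuousOn ρ (Ioo (-δ) δ)) (hρ0 : ∀ x ∈ Ioo (-δ) δ, 0 ≤ ρ x)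
    (hwin : m.restrict (Ioo (-δ) δ) =
      (volume.restrict (Ioo (-δ) δ)).withDensity (fun x => ENNReal.ofReal (ρ x)))
    {E r η ν e R R' : ℝ} (hr : 0 < r) (hη : 0 < η) (hν : 0 < ν) (he : 0 ≤ e)
    (hIW : Ioo (E - r) (E + r) ⊆ Ioo (-δ) δ)
    (hR : ∀ y ∈ Ioo (-r) r, |ρ (E + y) - ρ E| ≤ R) (hR' : |ρ E| ≤ R')
    (hge : ∀ y, |y| < η → |ρ (E + y) - ρ E| ≤ e) :
    |(∫ x, ν / ((x - E) ^ 2 + ν ^ 2) ∂m) - Real.pi * ρ E| ≤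
      Real.pi * e +
        ν * (R * volume.real (Ioo (-r) r) / η ^ 2 + 2 * R' / r + m.real univ / r ^ 2) := by
  have hI : MeasurableSet (Ioo (E - r) (E + r)) := measurableSet_Ioo
  -- split into window and tail
  have hsplit : ∫ x, ν / ((x - E) ^ 2 + ν ^ 2) ∂m =
      (∫ x in Ioo (E - r) (E + r), ν / ((x - E) ^ 2 + ν ^ 2) ∂m) +
        ∫ x in (Ioo (E - r) (E + r))ᶜ, ν / ((x - E) ^ 2 + ν ^ 2) ∂m :=
    (integral_add_compl hI (poissonLU_integrable_shift m E hν)).symm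
  -- the window part is a Lebesgue integral against `ρ`, translated to `(-r, r)`
  have hρI : ContinuousOn ρ (Ioo (E - r) (E + r)) := hρc.mono hIW
  have hwinI : ∫ x in Ioo (E - r) (E + r), ν / ((x - E) ^ 2 + ν ^ 2) ∂m =
      ∫ y in Ioo (-r) r, ν / (ν ^ 2 + y ^ 2) * ρ (E + y) := by
    rw [poissonLU_setIntegral_eq_of_restrict_eq_withDensity hI (fun x hx => hρ0 x (hIW hx))
      (hρI.aestronglyMeasurable hI).aemeasurable (poissonLU_restrict_eq_withDensity hwin hI hIW)
      (fun x => ν / ((x - E) ^ 2 + ν ^ 2))]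
    exact poissonLU_setIntegral_comp_add ρ E r ν
  -- integrability of the translated density
  have hgi : IntegrableOn (fun y => ρ (E + y)) (Ioo (-r) r) :=
    poissonLU_integrableOn_comp_add
      ((AbelOfSpectralDensity.integrableOn_of_restrict_eq_withDensity hρc hρ0 hwin).mono_set hIW)
  -- the core estimate at centre `0` for `y ↦ ρ (E + y)`
  have hge' : ∀ y, |y| < η → |ρ (E + y) - ρ (E + 0)| ≤ e := fun y hy => by
    rw [add_zero]; exact hge y hy
  have hcore := AbelOfSpectralDensity.abs_setIntegral_poisson_mul_sub_le (g := fun y => ρ (E + y))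
    hr hη hν he hgi hge'
  simp only [add_zero] at hcore
  -- the `L¹` oscillation on `(-r, r)` is at most `R · |(-r, r)|`
  have hB : ∫ y in Ioo (-r) r, |ρ (E + y) - ρ E| ≤ R * volume.real (Ioo (-r) r) := by
    refine le_trans (Real.le_norm_self _)
      (norm_setIntegral_le_of_norm_le_const measure_Ioo_lt_top (fun y hy => ?_))
    rw [Real.norm_eq_abs, abs_abs]
    exact hR y hy
  -- the tail
  have htail := poissonLU_norm_setIntegral_compl_le m E hr hν.le
  rw [Real.norm_eq_abs] at htail
  -- assemble
  have habs : ∀ a b c : ℝ, |a + b - c| ≤ |a - c| + |b| := fun a b c => by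
    rw [add_sub_right_comm]; exact abs_add_le _ _
  have h1 : ν / η ^ 2 * (∫ y in Ioo (-r) r, |ρ (E + y) - ρ E|) ≤
      ν / η ^ 2 * (R * volume.real (Ioo (-r) r)) := mul_le_mul_of_nonneg_left hB (by positivity)
  have h2 : |ρ E| * (2 * ν / r) ≤ R' * (2 * ν / r) :=
    mul_le_mul_of_nonneg_right hR' (by positivity)
  have h3 : ν * (R * volume.real (Ioo (-r) r) / η ^ 2 + 2 * R' / r + m.real univ / r ^ 2) =
      ν / η ^ 2 * (R * volume.real (Ioo (-r) r)) + R' * (2 * ν / r) + ν / r ^ 2 * m.real univ := by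
    ring
  rw [hsplit, hwinI]
  calc |(∫ y in Ioo (-r) r, ν / (ν ^ 2 + y ^ 2) * ρ (E + y)) +
          (∫ x in (Ioo (E - r) (E + r))ᶜ, ν / ((x - E) ^ 2 + ν ^ 2) ∂m) - Real.pi * ρ E|
      ≤ |(∫ y in Ioo (-r) r, ν / (ν ^ 2 + y ^ 2) * ρ (E + y)) - Real.pi * ρ E| +
          |∫ x in (Ioo (E - r) (E + r))ᶜ, ν / ((x - E) ^ 2 + ν ^ 2) ∂m| := habs _ _ _
    _ ≤ Real.pi * e +
          ν * (R * volume.real (Ioo (-r) r) / η ^ 2 + 2 * R' / r + m.real univ / r ^ 2) := by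
        linarith [hcore, htail]

/-! ### The registered stub -/

/-- **Stub B2 `stub_poissonLocallyUniform` — the locally uniform Poisson approximate identity.**
If a finite measure `m` on `ℝ` has on the window `(-δ, δ)` a continuous non-negative density `ρ`
with respect to Lebesgue measure, then its Poisson integrals `E ↦ ∫ ν/((x - E)² + ν²) dm(x)`
converge to `π ρ` locally uniformly on `(-δ, δ)` as `ν ↓ 0`: every `E₀` in the window has the
neighbourhood `[E₀ - r, E₀ + r]` (`[E₀ - 2r, E₀ + 2r] ⊆ (-δ, δ)`) on which, by the bound and the
uniform continuity of `ρ` on `[E₀ - 2r, E₀ + 2r]`, the per-centre estimate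
`poissonLU_abs_integral_sub_le` is uniform. [folklore] -/
theorem stub_poissonLocallyUniform :
    ∀ (m : MeasureTheory.Measure ℝ), MeasureTheory.IsFiniteMeasure m → ∀ δ : ℝ, 0 < δ → ∀ ρ : ℝ → ℝ,
      ContinuousOn ρ (Set.Ioo (-δ) δ) → (∀ x ∈ Set.Ioo (-δ) δ, 0 ≤ ρ x) →
      m.restrict (Set.Ioo (-δ) δ) = (volume.restrict (Set.Ioo (-δ) δ)).withDensity (fun x => ENNReal.ofReal (ρ x)) →
      TendstoLocallyUniformlyOn (fun (ν : ℝ) (E : ℝ) => ∫ x, ν / ((x - E) ^ 2 + ν ^ 2) ∂m)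
        (fun E => Real.pi * ρ E) (𝓝[>] (0 : ℝ)) (Set.Ioo (-δ) δ) := by
  intro m hm δ _ ρ hρc hρ0 hwin
  haveI := hm
  refine tendstoLocallyUniformlyOn_of_forall_exists_nhds (fun E₀ hE₀ => ?_)
  -- geometry: a radius `r > 0` with `[E₀ - 2r, E₀ + 2r] ⊆ (-δ, δ)`
  obtain ⟨r, hr, hK⟩ : ∃ r : ℝ, 0 < r ∧ Icc (E₀ - 2 * r) (E₀ + 2 * r) ⊆ Ioo (-δ) δ := by
    have h1 : 0 < δ + E₀ := by linarith [hE₀.1]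
    have h2 : 0 < δ - E₀ := by linarith [hE₀.2]
    refine ⟨min (δ + E₀) (δ - E₀) / 3, div_pos (lt_min h1 h2) (by norm_num), fun x hx => ⟨?_, ?_⟩⟩
    · have := min_le_left (δ + E₀) (δ - E₀)
      linarith [hx.1, hE₀.1]
    · have := min_le_right (δ + E₀) (δ - E₀)
      linarith [hx.2, hE₀.2]
  refine ⟨Icc (E₀ - r) (E₀ + r),
    mem_nhdsWithin_of_mem_nhds (Icc_mem_nhds (by linarith) (by linarith)), ?_⟩
  -- a bound and a modulus of uniform continuity for `ρ` on the compact `[E₀ - 2r, E₀ + 2r]`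
  have hρK : ContinuousOn ρ (Icc (E₀ - 2 * r) (E₀ + 2 * r)) := hρc.mono hK
  obtain ⟨R, hR⟩ := isCompact_Icc.exists_bound_of_continuousOn hρK
  have hUC : UniformContinuousOn ρ (Icc (E₀ - 2 * r) (E₀ + 2 * r)) :=
    isCompact_Icc.uniformContinuousOn_of_continuous hρK
  rw [Metric.tendstoUniformlyOn_iff]
  intro ε hε
  obtain ⟨e, he_def⟩ : ∃ e : ℝ, e = ε / (4 * Real.pi) := ⟨_, rfl⟩
  have he : 0 < e := by rw [he_def]; positivity
  obtain ⟨η₁, hη₁, hη₁ρ⟩ := Metric.uniformContinuousOn_iff.1 hUC e he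
  have hη : 0 < min η₁ r := lt_min hη₁ hr
  obtain ⟨C, hC_def⟩ : ∃ C : ℝ,
      C = (R + R) * volume.real (Ioo (-r) r) / (min η₁ r) ^ 2 + 2 * R / r + m.real univ / r ^ 2 :=
    ⟨_, rfl⟩
  have hlin : Tendsto (fun ν : ℝ => ν * C) (𝓝[>] 0) (𝓝 0) := by
    have h : Tendsto (fun ν : ℝ => ν * C) (𝓝 0) (𝓝 (0 * C)) := Continuous.tendsto (by fun_prop) 0
    rw [zero_mul] at h
    exact h.mono_left nhdsWithin_le_nhds
  have hev : ∀ᶠ ν in 𝓝[>] (0 : ℝ), ν * C < ε / 2 := hlin (Iio_mem_nhds (by positivity))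
  filter_upwards [hev, self_mem_nhdsWithin] with ν hν hνpos E hE
  rw [Real.dist_eq, abs_sub_comm]
  -- the centre `E ∈ [E₀ - r, E₀ + r]`: window `(E - r, E + r)`, constants `R + R`, `R`, `e`
  have hEK : E ∈ Icc (E₀ - 2 * r) (E₀ + 2 * r) := ⟨by linarith [hE.1], by linarith [hE.2]⟩
  have hIW : Ioo (E - r) (E + r) ⊆ Ioo (-δ) δ := fun x hx =>
    hK ⟨by linarith [hx.1, hE.1], by linarith [hx.2, hE.2]⟩
  have hRE : |ρ E| ≤ R := by
    have h := hR E hEK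
    rwa [Real.norm_eq_abs] at h
  have hR2 : ∀ y ∈ Ioo (-r) r, |ρ (E + y) - ρ E| ≤ R + R := fun y hy => by
    have h1 := hR (E + y) ⟨by linarith [hy.1, hE.1], by linarith [hy.2, hE.2]⟩
    rw [Real.norm_eq_abs] at h1
    exact (abs_sub _ _).trans (add_le_add h1 hRE)
  have hge : ∀ y, |y| < min η₁ r → |ρ (E + y) - ρ E| ≤ e := fun y hy => by
    have hyr : |y| < r := lt_of_lt_of_le hy (min_le_right _ _)
    have hy₁ : |y| < η₁ := lt_of_lt_of_le hy (min_le_left _ _)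
    rw [abs_lt] at hyr
    have hEy : E + y ∈ Icc (E₀ - 2 * r) (E₀ + 2 * r) :=
      ⟨by linarith [hyr.1, hE.1], by linarith [hyr.2, hE.2]⟩
    have h := hη₁ρ (E + y) hEy E hEK (by rwa [Real.dist_eq, add_sub_cancel_left])
    rw [Real.dist_eq] at h
    exact h.le
  calc |(∫ x, ν / ((x - E) ^ 2 + ν ^ 2) ∂m) - Real.pi * ρ E| ≤ Real.pi * e + ν * C := by
        rw [hC_def]
        exact poissonLU_abs_integral_sub_le hρc hρ0 hwin hr hη hνpos he.le hIW hR2 hRE hge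
    _ < ε := by
        have h1 : Real.pi * e = ε / 4 := by
          rw [he_def]
          field_simp
        linarith

end Summit.AtomisticToContinuum.FouriersLaw.Theorems.MourreDissolution

end
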